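import Literature.Computability.AlgebraicComplexity.PerDetHwvCertificateSemantics
import HarnessLib

/-!
# A verified per-side rank certificate plus a det-side DEFICIT hypothesis is a multiplicity obstruction

Topic `Literature/Computability/AlgebraicComplexity` (geometric complexity theory); proofs file
(ONE theorem; no definitions, no named facts). Written for cell `pub-gct-max` (track T, seat lit-2;
cost sheet `KERNEL-REPLAY-ESTIMATE-2` §5). HONEST FRAMING of that cell: multiplicity data and
certified rank bounds at small parameters; occurrence obstructions for determinant versus padded
permanent are ruled out in print (Bürgisser–Ikenmeyer–Panova 2019) — multiplicity obstructions are
the open door; `(per₃, det₄)` is a KNOWN separation, so a first obstruction there validates the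
method and gives no new bound; nothing here is a claim on VP ≠ VNP or P ≠ NP.

THE CONDITIONAL READING (verbatim, as registered by the cell): **the det-side inequality is a
hypothesis; this theorem certifies no obstruction by itself.**

What it does. The tree's certificate format `TableauEval.Cert` (`PerDetHwvCertificate.lean` §2)
with its kernel-checked verifier `Cert.verify` and the theorem `Cert.le_orbitMultiplicity`
(`PerDetHwvCertificateSemantics.lean` §4) PROVES per-side lower bounds
`c.r ≤ mult_{λ^*} K[Δ(X₀₀^{m-n} per_n)]` (the rank of an explicit minor of evaluations of tableau
highest-weight vectors at points of the orbit closure). The existing glue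
`Cert.perDetMultiplicityObstructionAt` / `Cert.perDetSymKroneckerObstructionAt` turns such a bound
into a multiplicity obstruction `PerDetMultiplicityObstructionAt n m d λ`
(`PerDetMultiplicityObstruction.lean`: `mult_{λ^*} K[Δ(det_m)] < mult_{λ^*} K[Δ(X₀₀^{m-n} per_n)]`,
`n ≤ m`, `ℓ(λ) ≤ m²`) ONLY through the symmetric Kronecker number, `sk(λ, m × d) ≤ c.sk < c.r`
(BLMW 2011 Prop. 5.2.1, the det-side ORBIT bound). In the parameter window the cell works in
(`n = 3`, `m = 4`, degrees `d ≤ 12`) that route is empty: `sk(λ, 4 × d) ≥ a_λ(d[4])` on every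
window type (cell record, KERNEL-REPLAY-ESTIMATE-2 FACT A), so an obstruction there needs a
det-side DEFICIT `mult_{λ^*} K[Δ(det_m)] ≤ r_det < a`, i.e. equations of the orbit closure of
`det_m` in low degree, for which no printed theorem exists below degree `2m(m−1)`
(Landsberg–Manivel–Ressayre 2013) and no kernel-replayable certificate is known. This file records
the honest shape of what can then be proved: the per side by certificate, the det side as the
hypothesis `hdet : mult_{λ^*} K[Δ(det_m)] < c.r`, supplied from outside the kernel (a cell
certificate of two implementations; a Monte-Carlo upper bound unless an exact rank-deficiency leg
is built) —

* `Cert.perDetMultiplicityObstructionAt_of_det_lt`: `c.verify = true`, `c.canonical = true` and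
  `mult_{λ^*} K[Δ(det_m)] < c.r` give `PerDetMultiplicityObstructionAt c.n c.m c.d λ`
  (characteristic zero), with `λ = c.lamPartition`, `λ^* = c.weight`.

Dörfler–Ikenmeyer–Panova 2020 §5 (obstructions from explicit highest-weight vectors and ranks on
BOTH sides) is the printed shape of such two-sided arguments; Bläser–Ikenmeyer 2025 §12.4 the
definition of a multiplicity obstruction; the tree's `PerDetMultiplicityObstructionAt.of_idealHwv`
(`HwvIdealRankBound.lean`) is the sibling that takes the det-side input as EXHIBITED ideal elements
instead of a number.

## References

* J. Dörfler, C. Ikenmeyer, G. Panova, *On geometric complexity theory: multiplicity obstructions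
  are stronger than occurrence obstructions*, SIAM J. Appl. Algebra Geom. 4 (2020), §5.
  [DorflerIkenmeyerPanova2020]
* M. Bläser, C. Ikenmeyer, *Introduction to geometric complexity theory*, Theory of Computing
  Graduate Surveys (2025), §12.4. [BlaeserIkenmeyer2025]
* P. Bürgisser, J. M. Landsberg, L. Manivel, J. Weyman, *An overview of mathematical issues arising
  in the geometric complexity theory approach to VP ≠ VNP*, SIAM J. Comput. 40 (2011), Prop. 5.2.1.
  [BLMW2011]
* P. Bürgisser, C. Ikenmeyer, G. Panova, *No occurrence obstructions in geometric complexity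
  theory*, J. AMS 32 (2019), §1.1. [BurgisserIkenmeyerPanovaJAMS2019]
-/

namespace Literature.Computability.AlgebraicComplexity

namespace TableauEval

open _root_.Literature.NumberTheory.DiophantineGeometry

namespace Cert

/-- **A verified canonical per-side certificate plus a det-side deficit is a multiplicity
obstruction** (characteristic zero): if `c.verify = true` and `c.canonical = true` (so that
`c.r ≤ mult_{λ^*} K[Δ(X₀₀^{m-n} per_n)]`, `Cert.le_orbitMultiplicity`) and the det-side
multiplicity satisfies `mult_{λ^*} K[Δ(det_m)] < c.r`, then `λ = c.lamPartition` is a multiplicity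
obstruction at `(n, m, d) = (c.n, c.m, c.d)` in the sense of `PerDetMultiplicityObstructionAt`.
THE DET-SIDE INEQUALITY IS A HYPOTHESIS; THIS THEOREM CERTIFIES NO OBSTRUCTION BY ITSELF.
Dörfler–Ikenmeyer–Panova 2020 §5 (two-sided highest-weight-vector arguments); the `sk`-route
sibling is `Cert.perDetMultiplicityObstructionAt`. [cite: DorflerIkenmeyerPanova2020, §5] -/
theorem perDetMultiplicityObstructionAt_of_det_lt (c : Cert) [NeZero c.m] {K : Type} [Field K]
    [CharZero K] (h : c.verify = true) (hcan : c.canonical = true)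
    (hdet : orbitMultiplicity K (detFormLex K c.m) c.m
      (c.weight (c.lam_pos_of_verify h) (c.lam_sum_of_verify h)) < c.r) :
    PerDetMultiplicityObstructionAt (k := K) c.n c.m c.d
      (c.lamPartition (c.lam_pos_of_verify h) (c.lam_sum_of_verify h)) := by
  have hS := c.spec_of_structural (c.structural_of_verify h)
  refine ⟨?_, hS.2.1, ?_⟩
  · rw [card_lamPartition]
    exact hS.2.2.1
  · exact lt_of_lt_of_le hdet (c.le_orbitMultiplicity (K := K) h hcan)

end Cert

end TableauEval

end Literature.Computability.AlgebraicComplexity
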